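/-
Copyright (c) 2026 the pub-hodgecm-mathlib formalisation cell (harness21).  Prover seat hodgecm-mathlib-F0P3a-p08 (g27): the «BALL SELECTION» slice of the E3a (L2) glue
(letter LH7-p04 (g8) 2026-09-02 17:36:45Z; dealt BY NAME by the E3a∕E3 pen LH3-p04 (g8) 18:02:49Z; consumer = (G1) «glue-PC» LH7-p04 (g9), binder `hSel`).
-/
import Literature.NumberTheory.Rogawski1990.ArchEPAssemblyBall   -- ★ (L2) §1 p852268 (LH7-p04 (g8)): `exists_uniform_radius_pi`; brings ★ E3b `isCompact_range_esymm3_cexp`, `esymm3`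
import HarnessLib

/-!
# EP assembly, layer (L2): the BALL SELECTION (one Lebesgue radius `δ` serving the generator radii AND the GT radius at a common centre tuple)

Topic `NumberTheory/Rogawski1990`; namespace `Literature.NumberTheory.Rogawski1990`.  THEOREMS ONLY (no definition, no instance, no notation, no named fact, no `sorry`); kernel lane
`--supports stmt-HodgeConjecture-24833`.  Cell `pub/hodgecm-mathlib` (D-0151), crux H413; HCML «GO 500» road N8-INNER ROAD B «EP road» (dealer LH2-plan (g1)), brick E3 «EP ASSEMBLY =
H-S4′», layer (L2) glue (pen LH3-p04 (g8), carving line 2026-09-02 17:56:25Z): (G1) «glue-PC» (LH7-p04 (g9)) consumes this file's head as its binder `hSel`.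
HONEST LABEL: count-neutral plumbing (pure topology); HC_CM is proved only modulo the 7 printed citations (2 remaining: hLiu418 = stmt-HodgeConjecture-24832,
h413 = stmt-HodgeConjecture-24833) until rung 0 closes.

WHAT.  In the ball-by-ball transfer (Rogawski 1990 §14.2 (14.2.1): the transfer is assembled from finitely many local pieces; Bouaziz 1994 §6.2: localisation on the class space)
every ball of the product partition of unity over the definite places `v ∈ D` must sit, at EVERY `v`, inside (r1∕r2) the EP generator's ball `ball (y v) (ε v (y v))` of SOME centre
tuple `y ∈ K^D` (★ E3b §4 `exists_epGenerator_choice`: radius `ε v b > 0` at every centre `b`, no continuity in `b`) and (r3) inside the GT-coupling ball `ball (y v) (ρGT y)` of the SAME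
tuple (★ (CP) `exists_coupling`: radius `ρGT y > 0` depending on the whole tuple, again with no continuity).  Since `K` (the one-place elliptic class image, ★ `isCompact_range_esymm3_cexp`)
is compact and the index is finite, ONE radius `δ > 0` works for all centre tuples `ctr ∈ K^D` at once — the Lebesgue number of the sup-metric boxes of radius
`ρ y := ρGT y ⊓ min_v ε v (y v)` (★ (L2) §1 `exists_uniform_radius_pi`; for an empty index the statement is vacuous):
* §1 `exists_ballSelection_of_pseudoMetricSpace` (any pseudo-metric space), `exists_ballSelection` (the lettered head, `ℂ × ℂ × ℂ`, compact `K` as a hypothesis),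
  `exists_ballSelection_esymm3` (the (G1) binder `hSel` BY BARE NAME: `K := range (esymm3 ∘ cexp)`, compactness discharged by ★ `isCompact_range_esymm3_cexp`);
* §2 the three CONSUMER COROLLARIES for a partition factor `F v` with `tsupport (F v) ⊆ ball (ctr v) δ`: (c-s2∕hgen) `F v z ≠ 0 → dist z (y v) < ε v (y v)`, (c-weight)
  `tsupport (F v) ⊆ {z | h v z ≠ 0}` whenever `h v ≠ 0` on the generator ball (the input of ★ (L2) §2 `contDiff_weight_of_tsupport_subset`), (c-GT) `F v z ≠ 0 → dist z (y v) < ρGT y`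
  (all by `subset_tsupport` ∕ `mem_ball`), one place at a time and over the whole index, and §3 the one-shot package `exists_ballSelection_consequences` (δ, then for every ball datum
  `(ctr, F)` a centre tuple `y` with the three consequences).

## References
* [Rogawski1990] J. D. Rogawski, *Automorphic Representations of Unitary Groups in Three Variables*, Ann. of Math. Stud. 123 (1990), §14.2 (14.2.1) p. 232.
* [Bouaziz1994IntegralesOrbitales] A. Bouaziz, *Intégrales orbitales sur les algèbres de Lie réductives*, Invent. Math. 115 (1994), §6.2 p. 591 (localisation on the class space).
-/

set_option autoImplicit false

open Set Metric Topology Complex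

namespace Literature.NumberTheory.Rogawski1990

/-! ## §1 The ball selection -/

section BallSelection

variable {ι : Type*} [Fintype ι] {X : Type*} [PseudoMetricSpace X]

/-- **BALL SELECTION (any pseudo-metric space).**  `K` compact, `ε v b > 0` a radius at every index and centre, `ρGT y > 0` a radius at every centre tuple in `K^ι` (no continuity
assumed for either): there is ONE `δ > 0` such that every tuple `ctr ∈ K^ι` admits a tuple `y ∈ K^ι` with `ball (ctr v) δ ⊆ ball (y v) (ε v (y v))` and `ball (ctr v) δ ⊆ ball (y v) (ρGT y)`
at EVERY index `v` — ★ `exists_uniform_radius_pi` for the radius `y ↦ ρGT y ⊓ min_v ε v (y v)` (empty index: vacuous, `δ := 1`, `y := ctr`).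
[cite: Bouaziz1994IntegralesOrbitales, §6.2 p. 591] [cite: Rogawski1990, §14.2 p. 232] -/
theorem exists_ballSelection_of_pseudoMetricSpace {K : Set X} (hK : IsCompact K) (ε : ι → X → ℝ) (hε : ∀ v b, 0 < ε v b)
    (ρGT : (ι → X) → ℝ) (hρ : ∀ y, (∀ v, y v ∈ K) → 0 < ρGT y) :
    ∃ δ : ℝ, 0 < δ ∧ ∀ ctr : ι → X, (∀ v, ctr v ∈ K) →
      ∃ y : ι → X, (∀ v, y v ∈ K) ∧ (∀ v, ball (ctr v) δ ⊆ ball (y v) (ε v (y v))) ∧ ∀ v, ball (ctr v) δ ⊆ ball (y v) (ρGT y) := by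
  rcases isEmpty_or_nonempty ι with hι | hι
  · exact ⟨1, one_pos, fun ctr hctr => ⟨ctr, hctr, fun v => isEmptyElim v, fun v => isEmptyElim v⟩⟩
  · -- the combined radius: the GT radius and the least generator radius over the (nonempty, finite) index
    obtain ⟨δ, hδ, hsel⟩ := exists_uniform_radius_pi hK
      (fun y => min (ρGT y) (Finset.univ.inf' Finset.univ_nonempty fun v => ε v (y v)))
      (fun y hy => lt_min (hρ y hy) ((Finset.lt_inf'_iff _).2 fun v _ => hε v (y v)))
    refine ⟨δ, hδ, fun ctr hctr => ?_⟩
    obtain ⟨y, hy, hball⟩ := hsel ctr hctr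
    refine ⟨y, hy, fun v => (hball v).trans (ball_subset_ball ?_), fun v => (hball v).trans (ball_subset_ball (min_le_left _ _))⟩
    exact (min_le_right _ _).trans (Finset.inf'_le _ (Finset.mem_univ v))

/-- **BALL SELECTION — THE LETTERED HEAD** (LH7-p04 (g8) 2026-09-02 17:36:45Z, token for token): on the one-place class space `ℂ × ℂ × ℂ`, for a compact `K`, positive generator radii
`ε v b` and a positive GT radius `ρGT y` on `K^ι`, ONE `δ > 0` such that every centre tuple `ctr ∈ K^ι` has a tuple `y ∈ K^ι` whose generator balls AND GT ball contain `ball (ctr v) δ` at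
every `v`. [cite: Bouaziz1994IntegralesOrbitales, §6.2 p. 591] [cite: Rogawski1990, §14.2 p. 232] -/
theorem exists_ballSelection {ι : Type*} [Fintype ι] {K : Set (ℂ × ℂ × ℂ)} (hK : IsCompact K) (ε : ι → ℂ × ℂ × ℂ → ℝ) (hε : ∀ v b, 0 < ε v b)
    (ρGT : (ι → ℂ × ℂ × ℂ) → ℝ) (hρ : ∀ y, (∀ v, y v ∈ K) → 0 < ρGT y) :
    ∃ δ, 0 < δ ∧ ∀ ctr : ι → ℂ × ℂ × ℂ, (∀ v, ctr v ∈ K) →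
      ∃ y, (∀ v, y v ∈ K) ∧ (∀ v, ball (ctr v) δ ⊆ ball (y v) (ε v (y v))) ∧ ∀ v, ball (ctr v) δ ⊆ ball (y v) (ρGT y) :=
  exists_ballSelection_of_pseudoMetricSpace hK ε hε ρGT hρ

/-- **BALL SELECTION ON THE ELLIPTIC CLASS IMAGE `K = range (esymm3 ∘ cexp)`** — the (G1) binder `hSel` by bare name (compactness by ★ `isCompact_range_esymm3_cexp`).
[cite: Rogawski1990, §3.6 p. 28; §14.2 p. 232] [cite: Bouaziz1994IntegralesOrbitales, §6.2 p. 591] -/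
theorem exists_ballSelection_esymm3 {ι : Type*} [Fintype ι] (ε : ι → ℂ × ℂ × ℂ → ℝ) (hε : ∀ v b, 0 < ε v b) (ρGT : (ι → ℂ × ℂ × ℂ) → ℝ)
    (hρ : ∀ y, (∀ v, y v ∈ Set.range fun t : Fin 3 → ℝ => esymm3 fun i => Complex.exp ((t i : ℂ) * I)) → 0 < ρGT y) :
    ∃ δ : ℝ, 0 < δ ∧ ∀ ctr : ι → ℂ × ℂ × ℂ, (∀ v, ctr v ∈ Set.range fun t : Fin 3 → ℝ => esymm3 fun i => Complex.exp ((t i : ℂ) * I)) →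
      ∃ y : ι → ℂ × ℂ × ℂ, (∀ v, y v ∈ Set.range fun t : Fin 3 → ℝ => esymm3 fun i => Complex.exp ((t i : ℂ) * I)) ∧
        (∀ v, ball (ctr v) δ ⊆ ball (y v) (ε v (y v))) ∧ ∀ v, ball (ctr v) δ ⊆ ball (y v) (ρGT y) :=
  exists_ballSelection isCompact_range_esymm3_cexp ε hε ρGT hρ

end BallSelection

/-! ## §2 The consumer corollaries (a partition factor supported in a selected ball) -/

section Consequences

variable {X : Type*} [PseudoMetricSpace X] {M : Type*} [Zero M] {N : Type*} [Zero N]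

/-- (c-s2∕hgen), one place: a factor `F` with `tsupport F ⊆ ball ctr δ ⊆ ball y r` is non-zero only at distance `< r` from `y`. [cite: Bouaziz1994IntegralesOrbitales, §6.2 p. 591] -/
theorem dist_lt_of_ne_zero_of_tsupport_subset_ball {F : X → M} {ctr y : X} {δ r : ℝ}
    (hF : tsupport F ⊆ ball ctr δ) (hsub : ball ctr δ ⊆ ball y r) : ∀ z, F z ≠ 0 → dist z y < r :=
  fun _ hz => mem_ball.1 (hsub (hF (subset_tsupport F (Function.mem_support.2 hz))))

/-- (c-weight), one place: if `h ≠ 0` on `ball y r` and `tsupport F ⊆ ball ctr δ ⊆ ball y r`, then `tsupport F ⊆ {h ≠ 0}` (the input of ★ `contDiff_weight_of_tsupport_subset`).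
[cite: Bouaziz1994IntegralesOrbitales, §6.2 p. 591] -/
theorem tsupport_subset_ne_zero_of_subset_ball {F : X → M} {h : X → N} {ctr y : X} {δ r : ℝ}
    (hF : tsupport F ⊆ ball ctr δ) (hsub : ball ctr δ ⊆ ball y r) (hh : ∀ z, dist z y < r → h z ≠ 0) : tsupport F ⊆ {z | h z ≠ 0} :=
  fun z hz => hh z (mem_ball.1 (hsub (hF hz)))

variable {ι : Type*}

/-- (c-s2∕hgen) over the index: `F v z ≠ 0 → dist z (y v) < ε v (y v)` (the «factor lives in the generator ball» clause of the readings dock). [cite: Bouaziz1994IntegralesOrbitales, §6.2 p. 591] -/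
theorem forall_dist_lt_of_ne_zero_of_tsupport_subset_ball {F : ι → X → M} {ctr y : ι → X} {δ : ℝ} {ε : ι → X → ℝ}
    (hF : ∀ v, tsupport (F v) ⊆ ball (ctr v) δ) (hsub : ∀ v, ball (ctr v) δ ⊆ ball (y v) (ε v (y v))) :
    ∀ v z, F v z ≠ 0 → dist z (y v) < ε v (y v) :=
  fun v => dist_lt_of_ne_zero_of_tsupport_subset_ball (hF v) (hsub v)

/-- (c-GT) over the index: `F v z ≠ 0 → dist z (y v) < ρGT y` (the guard of the coupling's transport identity on the GT box). [cite: Bouaziz1994IntegralesOrbitales, §6.2 p. 591] -/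
theorem forall_dist_lt_of_ne_zero_of_tsupport_subset_ball_const {F : ι → X → M} {ctr y : ι → X} {δ r : ℝ}
    (hF : ∀ v, tsupport (F v) ⊆ ball (ctr v) δ) (hsub : ∀ v, ball (ctr v) δ ⊆ ball (y v) r) :
    ∀ v z, F v z ≠ 0 → dist z (y v) < r :=
  fun v => dist_lt_of_ne_zero_of_tsupport_subset_ball (hF v) (hsub v)

/-- (c-weight) over the index: `tsupport (F v) ⊆ {z | h v z ≠ 0}` whenever `h v ≠ 0` on the generator ball of `y v`. [cite: Bouaziz1994IntegralesOrbitales, §6.2 p. 591] -/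
theorem forall_tsupport_subset_ne_zero_of_subset_ball {F : ι → X → M} {h : ι → X → N} {ctr y : ι → X} {δ : ℝ} {ε : ι → X → ℝ}
    (hF : ∀ v, tsupport (F v) ⊆ ball (ctr v) δ) (hsub : ∀ v, ball (ctr v) δ ⊆ ball (y v) (ε v (y v)))
    (hh : ∀ v z, dist z (y v) < ε v (y v) → h v z ≠ 0) : ∀ v, tsupport (F v) ⊆ {z | h v z ≠ 0} :=
  fun v => tsupport_subset_ne_zero_of_subset_ball (hF v) (hsub v) (hh v)

end Consequences

/-! ## §3 The one-shot package: `δ`, then a centre tuple with the three consequences for every ball datum -/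

section Package

variable {ι : Type*} [Fintype ι] {X : Type*} [PseudoMetricSpace X] {M : Type*} [Zero M] {N : Type*} [Zero N]

/-- **BALL SELECTION WITH ITS CONSEQUENCES (any pseudo-metric space).**  ONE `δ > 0` such that for every ball datum `(ctr ∈ K^ι, F)` with `tsupport (F v) ⊆ ball (ctr v) δ` some centre
tuple `y ∈ K^ι` satisfies (c-s2∕hgen) `F v z ≠ 0 → dist z (y v) < ε v (y v)`, (c-GT) `F v z ≠ 0 → dist z (y v) < ρGT y`, and (c-weight) `tsupport (F v) ⊆ {h v ≠ 0}` for every family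
`h` non-vanishing on the generator balls of `y`. [cite: Bouaziz1994IntegralesOrbitales, §6.2 p. 591] [cite: Rogawski1990, §14.2 p. 232] -/
theorem exists_ballSelection_consequences {K : Set X} (hK : IsCompact K) (ε : ι → X → ℝ) (hε : ∀ v b, 0 < ε v b)
    (ρGT : (ι → X) → ℝ) (hρ : ∀ y, (∀ v, y v ∈ K) → 0 < ρGT y) :
    ∃ δ : ℝ, 0 < δ ∧ ∀ ctr : ι → X, (∀ v, ctr v ∈ K) → ∀ F : ι → X → M, (∀ v, tsupport (F v) ⊆ ball (ctr v) δ) →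
      ∃ y : ι → X, (∀ v, y v ∈ K) ∧ (∀ v z, F v z ≠ 0 → dist z (y v) < ε v (y v)) ∧ (∀ v z, F v z ≠ 0 → dist z (y v) < ρGT y) ∧
        ∀ h : ι → X → N, (∀ v z, dist z (y v) < ε v (y v) → h v z ≠ 0) → ∀ v, tsupport (F v) ⊆ {z | h v z ≠ 0} := by
  obtain ⟨δ, hδ, hsel⟩ := exists_ballSelection_of_pseudoMetricSpace hK ε hε ρGT hρ
  refine ⟨δ, hδ, fun ctr hctr F hF => ?_⟩
  obtain ⟨y, hy, hε', hρ'⟩ := hsel ctr hctr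
  exact ⟨y, hy, forall_dist_lt_of_ne_zero_of_tsupport_subset_ball hF hε', forall_dist_lt_of_ne_zero_of_tsupport_subset_ball_const hF hρ',
    fun h hh => forall_tsupport_subset_ne_zero_of_subset_ball hF hε' hh⟩

/-- The same package on the elliptic class image `K = range (esymm3 ∘ cexp)` of `ℂ × ℂ × ℂ` (compactness by ★ `isCompact_range_esymm3_cexp`).
[cite: Rogawski1990, §3.6 p. 28; §14.2 p. 232] [cite: Bouaziz1994IntegralesOrbitales, §6.2 p. 591] -/
theorem exists_ballSelection_consequences_esymm3 (ε : ι → ℂ × ℂ × ℂ → ℝ) (hε : ∀ v b, 0 < ε v b) (ρGT : (ι → ℂ × ℂ × ℂ) → ℝ)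
    (hρ : ∀ y, (∀ v, y v ∈ Set.range fun t : Fin 3 → ℝ => esymm3 fun i => Complex.exp ((t i : ℂ) * I)) → 0 < ρGT y) :
    ∃ δ : ℝ, 0 < δ ∧ ∀ ctr : ι → ℂ × ℂ × ℂ, (∀ v, ctr v ∈ Set.range fun t : Fin 3 → ℝ => esymm3 fun i => Complex.exp ((t i : ℂ) * I)) →
      ∀ F : ι → ℂ × ℂ × ℂ → M, (∀ v, tsupport (F v) ⊆ ball (ctr v) δ) →
        ∃ y : ι → ℂ × ℂ × ℂ, (∀ v, y v ∈ Set.range fun t : Fin 3 → ℝ => esymm3 fun i => Complex.exp ((t i : ℂ) * I)) ∧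
          (∀ v z, F v z ≠ 0 → dist z (y v) < ε v (y v)) ∧ (∀ v z, F v z ≠ 0 → dist z (y v) < ρGT y) ∧
          ∀ h : ι → ℂ × ℂ × ℂ → N, (∀ v z, dist z (y v) < ε v (y v) → h v z ≠ 0) → ∀ v, tsupport (F v) ⊆ {z | h v z ≠ 0} :=
  exists_ballSelection_consequences isCompact_range_esymm3_cexp ε hε ρGT hρ

end Package

end Literature.NumberTheory.Rogawski1990
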